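import Summits.ValiantsHypothesis.ValiantsHypothesis.Theses.LacunarySymmetroid
import Summits.ValiantsHypothesis.ValiantsHypothesis.Theorems.LacunarySymmetroidPencilTransfer
import Summits.ValiantsHypothesis.ValiantsHypothesis.Theorems.LacunarySymmetroidThetaWitness

/-!
# `MatrixDescartes` — how much of the crux the route consumes: ANY constant-factor saving over `K log₂ K` closes it

CONDITIONAL: proves no part of MatrixDescartes; the hypothesis MDR(a,b) is OPEN and implies VH by this theorem, hence
≥ summit-hard; ROUTE-DESIGN DATUM: `closes` consumes only a constant-factor saving b/a < 1 in log₂ Z ≤ (b/a)·K⌊log₂K⌋.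

HONEST FRAMING.  Object-search cell `pub-symmetroid`, crux `Theses.LacunarySymmetroid.MatrixDescartes`
(ledger item `stmt-ValiantsHypothesis-18050`, route `LacunarySymmetroid`; seat `val-sym-mdr-p1`; desk GO R1336 (1)).
This file proves NO part of the crux and nothing unconditional about `VP ≠ VNP`.  It re-runs the route's own deciding
argument (`Theses.LacunarySymmetroid.closes`, with the PROVED cruxes `pencilTransfer_proof` (stmt-18051) and
`thetaWitness_proof` (stmt-18052)) from a WEAKER hypothesis than the crux as typed — here called MDR(a,b), stated
INLINE (no new `Prop` is registered) — and records the exact exchange rate: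

* The crux asks `Z^q ≤ 2^(K⌊log₂K⌋)` for EVERY `q` (i.e. `log₂ Z = o(K log K)`) eventually in `K`, uniformly for
  `m ≤ 2^((⌊log₂K⌋+c)^c)`; the cell's `K1-PENCILTRANSFER-ANSWER.md` §5 (R1) observed that `closes` uses `q = 4` only.
* **Here (`valiant_of_matrixDescartesRatio`): for ANY naturals `b < a`, the hypothesis
  «`∀ c, ∃ K₀, ∀ K ≥ K₀, ∀ m ≤ 2^((⌊log₂K⌋+c)^c)`, every symmetric `K`-term `m × m` lacunary pencil has
  `Z^a ≤ 2^(b·K⌊log₂K⌋)`» — that is, `log₂ Z ≤ (b/a)·K log₂ K`, a CONSTANT-FACTOR saving over the witness rate,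
  not `o(K log K)` — already implies `ValiantsHypothesis` (`VP ≠ VNP` over `ℂ`).**  The witness side supplies
  `log₂ Z ≥ n⌊log₂n⌋ − 1` at `K = n+1` terms; the transfer supplies the quasi-polynomial size; the arithmetic
  `a(n⌊log₂n⌋ − 1) ≤ b(n+1)(⌊log₂n⌋+1)` fails for large `n` exactly when `b < a`.
* `valiant_of_matrixDescartesRatio_io` (appended): the same with the bound assumed only for INFINITELY MANY `K`
  (per `c`), since the witness holds for all large `n`; `matrixDescartesRatio_io_of_eventually` links the two forms.
* Conversely the crux as typed implies every such hypothesis with `b ≥ 1` (`matrixDescartesRatio_of_matrixDescartes`),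
  so the family «ratio `b/a < 1`» sits between the crux and the summit: `MatrixDescartes ⇒ (ratio b/a) ⇒ VH`.

What this is NOT: the weakened hypothesis is still OPEN and still at least summit-hard (it implies `VH` by this very
file); Descartes' rule gives only `log₂ Z ≤ K·(⌊log₂K⌋+c)^c` in the regime, not `≤ b·K log₂ K` for any fixed `b`
once `c ≥ 2`.  The file only tells the planner that the item may be RE-TYPED with a single pair `b < a` (e.g.
`Z^2 ≤ 2^(K⌊log₂K⌋)`, or `Z^(t+1) ≤ 2^(t·K⌊log₂K⌋)` for any `t`) without losing the route.  Nothing here bears on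
`DoorA26` / `DoorA34` or on any census numeral.

[folklore] The proof is the route file's `closes` with the exponent bookkeeping generalised from `(4, 1)` to `(a, b)`.
-/

-- `Summit.ValiantsHypothesis.ValiantsHypothesis.…` repeats a component by the D-0017 layout
-- (single-conjunct summit), which the `dupNamespace` linter flags; the name is mandated.
set_option linter.dupNamespace false

namespace Summit.ValiantsHypothesis.ValiantsHypothesis.Theorems.LacunarySymmetroidMatrixDescartes.Census

open Summit.ValiantsHypothesis.ValiantsHypothesis.Theses.LacunarySymmetroid (MatrixDescartes)
open scoped BigOperators

/-- The crux as typed implies every ratio form with `b ≥ 1` (any `a`): `Z^a ≤ 2^(K⌊log₂K⌋) ≤ 2^(b·K⌊log₂K⌋)`.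
(Trivial direction, recorded so that the ratio family is visibly sandwiched between the crux and the summit.)
[folklore] -/
theorem matrixDescartesRatio_of_matrixDescartes (h : MatrixDescartes) (a b : ℕ) (ha : 0 < a) (hb : 1 ≤ b) :
    ∀ c : ℕ, ∃ K₀ : ℕ, ∀ K m : ℕ, K₀ ≤ K → m ≤ 2 ^ ((Nat.log 2 K + c) ^ c) →
      ∀ (d : Fin K → ℕ) (S : Fin K → Matrix (Fin m) (Fin m) ℝ), (∀ l, (S l).IsSymm) →
        (Matrix.det (∑ l, ((Polynomial.X : Polynomial ℝ) ^ d l) • (S l).map Polynomial.C)).roots.toFinset.card ^ a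
          ≤ 2 ^ (b * (K * Nat.log 2 K)) := by
  intro c
  obtain ⟨K₀, hK₀⟩ := h c a ha
  refine ⟨K₀, fun K m hK hm d S hS => (hK₀ K m hK hm d S hS).trans ?_⟩
  exact Nat.pow_le_pow_right (by norm_num) (Nat.le_mul_of_pos_left _ hb)

/-- **Any constant-factor saving closes the route.**  Let `b < a`.  If for every `c` there is `K₀` such that for all
`K ≥ K₀`, all `m ≤ 2^((⌊log₂K⌋+c)^c)`, all exponents and all real symmetric coefficients the `K`-term `m × m`
lacunary pencil satisfies `Z^a ≤ 2^(b·K⌊log₂K⌋)` (`Z` = number of distinct real zeros of its determinant), then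
`VP ≠ VNP` over `ℂ`.  Proof = the route's `closes`: under `VP = VNP` the proved witness `thetaWitness_proof` is a VP
family with `≥ 2^(n⌊log₂n⌋) − 1` real zeros on a monomial curve, the proved transfer `pencilTransfer_proof` makes it
the zero set of a symmetric `(n+1)`-term pencil of quasi-polynomial size, and `a(n⌊log₂n⌋ − 1) ≤ b(n+1)(⌊log₂n⌋+1)`
is false for `n ≥ 2^(2b+1) + a + b + 2`.  The hypothesis is OPEN (weaker than `MatrixDescartes`, still summit-hard). [folklore] -/
theorem valiant_of_matrixDescartesRatio (a b : ℕ) (hab : b < a)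
    (h : ∀ c : ℕ, ∃ K₀ : ℕ, ∀ K m : ℕ, K₀ ≤ K → m ≤ 2 ^ ((Nat.log 2 K + c) ^ c) →
      ∀ (d : Fin K → ℕ) (S : Fin K → Matrix (Fin m) (Fin m) ℝ), (∀ l, (S l).IsSymm) →
        (Matrix.det (∑ l, ((Polynomial.X : Polynomial ℝ) ^ d l) • (S l).map Polynomial.C)).roots.toFinset.card ^ a
          ≤ 2 ^ (b * (K * Nat.log 2 K))) :
    _root_.ValiantsHypothesis := by
  show Literature.Computability.AlgebraicComplexity.VP ℂ ≠ Literature.Computability.AlgebraicComplexity.VNP ℂ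
  intro hEq
  obtain ⟨Θ, d, hVNP, n₀, hroots⟩ := LacunarySymmetroid.thetaWitness_proof
  have hVP : Literature.Computability.AlgebraicComplexity.IsVPFamily
      (fun n => MvPolynomial.map (algebraMap ℝ ℂ) (Θ n)) := by
    have hmem := (Literature.Computability.AlgebraicComplexity.mem_VNP_ofFintype_iff_holds _).2 hVNP
    rw [← hEq] at hmem
    exact (Literature.Computability.AlgebraicComplexity.mem_VP_ofFintype_iff_holds _).1 hmem
  obtain ⟨c, hc⟩ := LacunarySymmetroid.pencilTransfer_proof (fun n => n) Θ hVP d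
  obtain ⟨K₀, hK⟩ := h c
  obtain ⟨N, hN⟩ : ∃ N : ℕ, 2 ^ (2 * b + 1) = N := ⟨_, rfl⟩
  obtain ⟨n, hn₀, hnK, hnB, hnA⟩ :
      ∃ n, n₀ ≤ n ∧ K₀ ≤ n ∧ N ≤ n ∧ a + b + 2 ≤ n :=
    ⟨n₀ + K₀ + N + a + b + 2, by omega, by omega, by omega, by omega⟩
  rw [← hN] at hnB
  obtain ⟨m, hm, S, hS, hroot⟩ := hc n
  set Z := (MvPolynomial.aeval (fun i => (Polynomial.X : Polynomial ℝ) ^ d n i) (Θ n)).roots.toFinset.card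
    with hZ
  have hm' : m ≤ 2 ^ ((Nat.log 2 (n + 1) + c) ^ c) :=
    hm.trans (Nat.pow_le_pow_right (by norm_num)
      (Nat.pow_le_pow_left (Nat.add_le_add_right (Nat.log_mono_right (Nat.le_succ n)) c) c))
  have h1 := hK (n + 1) m (by omega) hm' (Fin.cons (α := fun _ => ℕ) (0 : ℕ) (d n)) S hS
  rw [hroot] at h1
  have h2 : 2 ^ (n * Nat.log 2 n) ≤ Z + 1 := hroots n hn₀
  set L := Nat.log 2 n with hL
  have hL2 : 2 * b + 1 ≤ L := by
    rw [hL]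
    exact Nat.le_log_of_pow_le one_lt_two hnB
  have hLn : L ≤ n := by rw [hL]; exact Nat.log_le_self 2 n
  have hL' : Nat.log 2 (n + 1) ≤ L + 1 := by
    rw [hL]
    calc Nat.log 2 (n + 1) ≤ Nat.log 2 (n * 2) := Nat.log_mono_right (by omega)
      _ = Nat.log 2 n + 1 := Nat.log_mul_base (by norm_num) (by omega)
  have h3 : Z ^ a ≤ 2 ^ (b * ((n + 1) * (L + 1))) :=
    h1.trans (Nat.pow_le_pow_right (by norm_num) (Nat.mul_le_mul_left _ (Nat.mul_le_mul_left _ hL')))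
  have hnL : 1 ≤ n * L := by nlinarith
  have h4 : 2 ^ (n * L - 1) ≤ Z := by
    have e : 2 ^ (n * L) = 2 * 2 ^ (n * L - 1) := by
      rw [← Nat.pow_succ']
      congr 1
      omega
    have h2' := h2
    rw [e] at h2'
    have : 1 ≤ 2 ^ (n * L - 1) := Nat.one_le_two_pow
    omega
  have h5 : 2 ^ (a * (n * L - 1)) ≤ Z ^ a := by
    rw [pow_mul']
    exact Nat.pow_le_pow_left h4 a
  have h6 : a * (n * L - 1) ≤ b * ((n + 1) * (L + 1)) :=
    (Nat.pow_le_pow_iff_right (by norm_num)).1 (h5.trans h3)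
  -- the arithmetic: with P' := nL − 1, (b+1)P' ≤ aP' ≤ bP' + bn + bL + 2b, while P' + 1 = nL ≥ (2b+1)n
  have i1 : (b + 1) * (n * L - 1) ≤ a * (n * L - 1) := Nat.mul_le_mul_right _ hab
  have i2 : n * (2 * b + 1) ≤ n * L := Nat.mul_le_mul_left n hL2
  have i3 : b * L ≤ b * n := Nat.mul_le_mul_left b hLn
  have e1 : (b + 1) * (n * L - 1) = b * (n * L - 1) + (n * L - 1) := by ring
  have e2 : n * (2 * b + 1) = 2 * (b * n) + n := by ring
  have e3 : b * ((n + 1) * (L + 1)) = b * (n * L - 1) + b * n + b * L + 2 * b := by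
    have e : (n + 1) * (L + 1) = (n * L - 1) + n + L + 2 := by
      zify [hnL]
      ring
    rw [e]
    ring
  rw [e1] at i1
  rw [e2] at i2
  rw [e3] at h6
  generalize hP : n * L - 1 = P at i1 h6
  have hP1 : P + 1 = n * L := by omega
  generalize hQ : b * P = Q at i1 h6
  generalize hR : a * P = R at i1 h6
  generalize hbn : b * n = U at i2 i3 h6
  generalize hbL : b * L = V at i3 h6
  generalize hnL' : n * L = W at i2 hP1
  omega

/-- **Infinitely often suffices (appended 2026-08-26, same seat).**  The deciding argument needs the ratio bound at ONE
suitable number of terms `K = n+1` beyond any given threshold, because the proved witness holds for ALL large `n` and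
the proved transfer for all `n`.  Hence: for `b < a`, if for every `c` and every `K₁` there is SOME `K ≥ K₁` at which
every `K`-term real symmetric `m × m` lacunary pencil with `m ≤ 2^((⌊log₂K⌋+c)^c)` has `Z^a ≤ 2^(b·K⌊log₂K⌋)`, then
`VP ≠ VNP` over `ℂ`.  So the route consumes the ratio bound only INFINITELY OFTEN in `K`, not eventually — whereas
refuting the crux AS TYPED needs a violating family only infinitely often (`Census.not_matrixDescartes_of_powerExtremal_io`);
a family that is Descartes-extremal for infinitely many `K` but obeys the ratio bound for infinitely many other `K`
would refute `MatrixDescartes` as typed and still leave this door open.  CONDITIONAL: the hypothesis is OPEN and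
implies `VH`, hence ≥ summit-hard; nothing is asserted about it. [folklore] -/
theorem valiant_of_matrixDescartesRatio_io (a b : ℕ) (hab : b < a)
    (h : ∀ c K₁ : ℕ, ∃ K : ℕ, K₁ ≤ K ∧ ∀ m : ℕ, m ≤ 2 ^ ((Nat.log 2 K + c) ^ c) →
      ∀ (d : Fin K → ℕ) (S : Fin K → Matrix (Fin m) (Fin m) ℝ), (∀ l, (S l).IsSymm) →
        (Matrix.det (∑ l, ((Polynomial.X : Polynomial ℝ) ^ d l) • (S l).map Polynomial.C)).roots.toFinset.card ^ a
          ≤ 2 ^ (b * (K * Nat.log 2 K))) :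
    _root_.ValiantsHypothesis := by
  show Literature.Computability.AlgebraicComplexity.VP ℂ ≠ Literature.Computability.AlgebraicComplexity.VNP ℂ
  intro hEq
  obtain ⟨Θ, d, hVNP, n₀, hroots⟩ := LacunarySymmetroid.thetaWitness_proof
  have hVP : Literature.Computability.AlgebraicComplexity.IsVPFamily
      (fun n => MvPolynomial.map (algebraMap ℝ ℂ) (Θ n)) := by
    have hmem := (Literature.Computability.AlgebraicComplexity.mem_VNP_ofFintype_iff_holds _).2 hVNP
    rw [← hEq] at hmem
    exact (Literature.Computability.AlgebraicComplexity.mem_VP_ofFintype_iff_holds _).1 hmem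
  obtain ⟨c, hc⟩ := LacunarySymmetroid.pencilTransfer_proof (fun n => n) Θ hVP d
  obtain ⟨N, hN⟩ : ∃ N : ℕ, 2 ^ (2 * b + 1) = N := ⟨_, rfl⟩
  obtain ⟨K, hK₁, hK⟩ := h c (n₀ + N + a + b + 3)
  obtain ⟨n, rfl⟩ : ∃ n, K = n + 1 := ⟨K - 1, by omega⟩
  have hn₀ : n₀ ≤ n := by omega
  have hnB : 2 ^ (2 * b + 1) ≤ n := by rw [hN]; omega
  have hnA : a + b + 2 ≤ n := by omega
  obtain ⟨m, hm, S, hS, hroot⟩ := hc n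
  set Z := (MvPolynomial.aeval (fun i => (Polynomial.X : Polynomial ℝ) ^ d n i) (Θ n)).roots.toFinset.card
    with hZ
  have hm' : m ≤ 2 ^ ((Nat.log 2 (n + 1) + c) ^ c) :=
    hm.trans (Nat.pow_le_pow_right (by norm_num)
      (Nat.pow_le_pow_left (Nat.add_le_add_right (Nat.log_mono_right (Nat.le_succ n)) c) c))
  have h1 := hK m hm' (Fin.cons (α := fun _ => ℕ) (0 : ℕ) (d n)) S hS
  rw [hroot] at h1
  have h2 : 2 ^ (n * Nat.log 2 n) ≤ Z + 1 := hroots n hn₀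
  set L := Nat.log 2 n with hL
  have hL2 : 2 * b + 1 ≤ L := by
    rw [hL]
    exact Nat.le_log_of_pow_le one_lt_two hnB
  have hLn : L ≤ n := by rw [hL]; exact Nat.log_le_self 2 n
  have hL' : Nat.log 2 (n + 1) ≤ L + 1 := by
    rw [hL]
    calc Nat.log 2 (n + 1) ≤ Nat.log 2 (n * 2) := Nat.log_mono_right (by omega)
      _ = Nat.log 2 n + 1 := Nat.log_mul_base (by norm_num) (by omega)
  have h3 : Z ^ a ≤ 2 ^ (b * ((n + 1) * (L + 1))) :=
    h1.trans (Nat.pow_le_pow_right (by norm_num) (Nat.mul_le_mul_left _ (Nat.mul_le_mul_left _ hL')))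
  have hnL : 1 ≤ n * L := by nlinarith
  have h4 : 2 ^ (n * L - 1) ≤ Z := by
    have e : 2 ^ (n * L) = 2 * 2 ^ (n * L - 1) := by
      rw [← Nat.pow_succ']
      congr 1
      omega
    have h2' := h2
    rw [e] at h2'
    have : 1 ≤ 2 ^ (n * L - 1) := Nat.one_le_two_pow
    omega
  have h5 : 2 ^ (a * (n * L - 1)) ≤ Z ^ a := by
    rw [pow_mul']
    exact Nat.pow_le_pow_left h4 a
  have h6 : a * (n * L - 1) ≤ b * ((n + 1) * (L + 1)) :=
    (Nat.pow_le_pow_iff_right (by norm_num)).1 (h5.trans h3)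
  have i1 : (b + 1) * (n * L - 1) ≤ a * (n * L - 1) := Nat.mul_le_mul_right _ hab
  have i2 : n * (2 * b + 1) ≤ n * L := Nat.mul_le_mul_left n hL2
  have i3 : b * L ≤ b * n := Nat.mul_le_mul_left b hLn
  have e1 : (b + 1) * (n * L - 1) = b * (n * L - 1) + (n * L - 1) := by ring
  have e2 : n * (2 * b + 1) = 2 * (b * n) + n := by ring
  have e3 : b * ((n + 1) * (L + 1)) = b * (n * L - 1) + b * n + b * L + 2 * b := by
    have e : (n + 1) * (L + 1) = (n * L - 1) + n + L + 2 := by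
      zify [hnL]
      ring
    rw [e]
    ring
  rw [e1] at i1
  rw [e2] at i2
  rw [e3] at h6
  generalize hP : n * L - 1 = P at i1 h6
  have hP1 : P + 1 = n * L := by omega
  generalize hQ : b * P = Q at i1 h6
  generalize hR : a * P = R at i1 h6
  generalize hbn : b * n = U at i2 i3 h6
  generalize hbL : b * L = V at i3 h6
  generalize hnL' : n * L = W at i2 hP1
  omega

/-- The «eventually» form is the special case `K := max K₀ K₁` of the «infinitely often» form. [folklore] -/
theorem matrixDescartesRatio_io_of_eventually (a b : ℕ)
    (h : ∀ c : ℕ, ∃ K₀ : ℕ, ∀ K m : ℕ, K₀ ≤ K → m ≤ 2 ^ ((Nat.log 2 K + c) ^ c) →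
      ∀ (d : Fin K → ℕ) (S : Fin K → Matrix (Fin m) (Fin m) ℝ), (∀ l, (S l).IsSymm) →
        (Matrix.det (∑ l, ((Polynomial.X : Polynomial ℝ) ^ d l) • (S l).map Polynomial.C)).roots.toFinset.card ^ a
          ≤ 2 ^ (b * (K * Nat.log 2 K))) :
    ∀ c K₁ : ℕ, ∃ K : ℕ, K₁ ≤ K ∧ ∀ m : ℕ, m ≤ 2 ^ ((Nat.log 2 K + c) ^ c) →
      ∀ (d : Fin K → ℕ) (S : Fin K → Matrix (Fin m) (Fin m) ℝ), (∀ l, (S l).IsSymm) →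
        (Matrix.det (∑ l, ((Polynomial.X : Polynomial ℝ) ^ d l) • (S l).map Polynomial.C)).roots.toFinset.card ^ a
          ≤ 2 ^ (b * (K * Nat.log 2 K)) := by
  intro c K₁
  obtain ⟨K₀, hK₀⟩ := h c
  exact ⟨max K₀ K₁, le_max_right _ _, fun m hm d S hS => hK₀ _ m (le_max_left _ _) hm d S hS⟩

end Summit.ValiantsHypothesis.ValiantsHypothesis.Theorems.LacunarySymmetroidMatrixDescartes.Census
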